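import Literature.Barriers.Schanuel.AxSchanuelFunctionalNotNumerical
import HarnessLib

/-!
# Ax–Schanuel barrier: the functional-soft technique class collapses to the soft one

Companion to `Literature/Barriers/Schanuel/AxSchanuelFunctionalNotNumerical.lean` (barrier
catalogue entry, D-0021) and its model-theoretic sibling `AxiomsDoNotForceSchanuel.lean`. This file
adds no definitions and no named facts; it combines results already proved in the tree:

* (removed 2026-08-16) the deprecated capitalised restatement `AxSchanuelFunctionalNotNumerical_holds`
  of the tree's discharge `axSchanuelFunctionalNotNumerical_holds` (dedup-00600): it had no users and,
  as an importable duplicate, made every resubmission of `AxSchanuelFunctionalNotNumerical.lean` bounce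
  `dedup.landed`; use `axSchanuelFunctionalNotNumerical_holds`.
* `functionalSoftDerivationOfSchanuel_iff_soft` — PROVED, unconditional: because Kirby's Theorem 1.2
  (the weak Schanuel property, from Ax's theorem) holds in EVERY exponential field of characteristic
  zero (`Literature.NumberTheory.Transcendental.Kirby2010_weakSchanuel_holds_type0`), the technique
  class `FunctionalSoftDerivationOfSchanuel` ("Zilber's axioms 1, 2, 4, 5 + quasiminimality +
  `#F = 𝔠` + weak Schanuel ⟹ Schanuel property") is EQUIVALENT to the soft class
  `SoftDerivationOfSchanuel` ("adding it to the soft axioms changes nothing"), and hence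
  (`functionalSoftDerivationOfSchanuel_iff_forall_isSoftZilberField`) to "every soft Zilber field has
  the Schanuel property".

## Status of `FunctionalSoftDerivationOfSchanuel` (why there is no `FunctionalSoftDerivationOfSchanuel_holds`)

`FunctionalSoftDerivationOfSchanuel`, like `FunctionalDerivationOfSchanuel` and
`SoftDerivationOfSchanuel`, is a closed TECHNIQUE-CLASS proposition (D-0021 "explicit_class"): the
statement the barrier REFUTES, not a result printed in the sources. Kirby proves Theorem 1.2 for
every exponential field and adds: "The full Schanuel property states that `δ(x̄) ≥ 0` for all `x̄`
… In the complex case this is Schanuel's conjecture, which is considered out of reach"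
[Kirby2010, §1 p. 3]; Bays–Kirby construct the quasiminimal exponential fields `𝔹_P` of cardinality
continuum with axioms 1, 2, 4, 5 "except that Schanuel's conjecture has this exception", and
conclude "soft methods which ignore transcendental number theory and analytic considerations
cannot hope to work" [BaysKirby2018ANT, §9.2]. In the tree: `not_functionalDerivationOfSchanuel`
(unconditional) and `not_functionalSoftDerivationOfSchanuel (h : baysKirby2018_modelsWithoutSchanuel)`;
so a `theorem FunctionalSoftDerivationOfSchanuel_holds` together with the Bays–Kirby named fact
would prove `False`. It is never to be discharged; by `functionalSoftDerivationOfSchanuel_iff_soft`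
it is moreover a duplicate, up to provable equivalence, of `SoftDerivationOfSchanuel`.

## References

* [Kirby2010] J. Kirby, *Exponential algebraicity in exponential fields*, Bull. Lond. Math. Soc. 42
  (2010) 879–890 (arXiv:0810.4285), §1 Theorems 1.1–1.2 and the paragraph after Theorem 1.3 (p. 3).
* [Ax1971] J. Ax, *On Schanuel's conjectures*, Ann. of Math. 93 (1971) 252–268, Thm. 3.
* [BaysKirby2018ANT] M. Bays, J. Kirby, *Pseudo-exponential maps, variants, and quasiminimality*,
  Algebra & Number Theory 12 (2018) 493–549 (arXiv:1512.04262), §9.1 Theorem 9.1, §9.2 (p. 28).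
-/

noncomputable section

namespace Literature.Barriers.Schanuel

/-! ### The functional-soft technique class is the soft technique class -/

/-- **The functional enlargement collapses to the soft class** (PROVED, unconditional): Kirby's
Thm. 1.2 holds in EVERY exponential field of characteristic zero
(`Literature.NumberTheory.Transcendental.Kirby2010_weakSchanuel_holds_type0`, from Ax's theorem),
so adding it to Zilber's other axioms changes nothing — `FunctionalSoftDerivationOfSchanuel` is
EQUIVALENT to the soft technique class `SoftDerivationOfSchanuel`. Consequently
`FunctionalSoftDerivationOfSchanuel` is, like `SoftDerivationOfSchanuel`, the closed proposition the
barrier REFUTES (`not_functionalSoftDerivationOfSchanuel`, from the Bays–Kirby named fact — the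
models `𝔹_P` of §9.2) and not a claim of the sources: it is never to be discharged (a
`theorem FunctionalSoftDerivationOfSchanuel_holds` together with `baysKirby2018_modelsWithoutSchanuel`
would prove `False`). "The full Schanuel property states that `δ(x̄) ≥ 0` for all `x̄` … In the
complex case this is Schanuel's conjecture, which is considered out of reach."
[cite: Kirby2010, Thm. 1.2 and §1 p. 3] -/
theorem functionalSoftDerivationOfSchanuel_iff_soft :
    FunctionalSoftDerivationOfSchanuel ↔ SoftDerivationOfSchanuel := by
  constructor
  · intro h F _ _ _ h1 h2 h3 h4 h5 h6 h7
    exact h F h1 h2 h3 h4 h5 h6 h7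
      (Literature.NumberTheory.Transcendental.Kirby2010_weakSchanuel_holds_type0 F)
  · intro h F _ _ _ h1 h2 h3 h4 h5 h6 h7 _
    exact h F h1 h2 h3 h4 h5 h6 h7

/-- **Through the class of objects** (PROVED, unconditional): `FunctionalSoftDerivationOfSchanuel`
says exactly that every soft Zilber field in `Type` (`IsSoftZilberField`: cardinality `𝔠`, Zilber's
axioms 1, 2, 4, 5 of Bays–Kirby's Theorem 9.1 with axiom 4 in the printed linear-independence
form, and quasiminimality) has the Schanuel property — the statement refuted, given the named
fact, by `exists_isSoftZilberField_not_schanuelProperty` /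
`not_forall_isSoftZilberField_schanuelProperty`. [cite: BaysKirby2018ANT, §9.1 Theorem 9.1 and §9.2] -/
theorem functionalSoftDerivationOfSchanuel_iff_forall_isSoftZilberField :
    FunctionalSoftDerivationOfSchanuel ↔
      ∀ (F : Type) [Field F] [CharZero F]
        [Literature.ModelTheory.ExponentialFields.ExponentialRing F],
        IsSoftZilberField F → Literature.ModelTheory.ExponentialFields.SchanuelProperty F :=
  functionalSoftDerivationOfSchanuel_iff_soft.trans softDerivationOfSchanuel_iff

end Literature.Barriers.Schanuel

end
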